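import Summits.AnomalousDissipation.AnomalousDissipation.Theorems.TwoAndHalfDTwohalfdNegRegularCondensateLimitTools
import HarnessLib

/-!
# Regular-condensate theorem: the block limit solves the sourced transport equation

Summit `AnomalousDissipation`, route `TwoAndHalfD`, crux `TwohalfdNeg`
(item stmt-AnomalousDissipation-0211), line `log-kantorovich-enstrophy-transfer`, lead c7
programme "regular-condensate theorem" (good blocks → restart → Arzelà–Ascoli + weak `L²`
limits → **the limit solves the sourced TRANSPORT equation** → `κ = 0` conservative balance →
ODE endgame). This file proves the registered stub `stub_rcLimit` (RC-LIM).

Along a sequence of levels `k`: restarted weak sourced scalars `ϑ k` on `[0, S+1)`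
(`Torus.IsWeakScalarTransportForcedOn (S+1) (ν k) (v k) (fun _ => h) (ϑ₀ k) (ϑ k)`, viscosities
`ν k → 0`, the same steady smooth source `h`), uniformly bounded in `L²((0,S) × T²)`, with drifts
`v k` that are `L²((0,S) × T²)`-asymptotic to bounded continuous comparison flows `W k`
converging uniformly on `[0,S] × T²` to a bounded continuous `W'`, weakly divergence free at
every time; and weak limits `Θ` (against bounded measurable space–time functions) and `Θ₀`
(against `L²(T²)`). Then `Θ` is a weak solution of `∂ₜΘ + W'·∇Θ = h` on `T² × [0,S)` with datum
`Θ₀`, i.e. `Torus.IsWeakScalarTransportForcedOn S 0 W' (fun _ => h) Θ₀ Θ`.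

Proof (DiPerna–Lions 1989, §II.1, stability of distributional solutions of a linear transport
equation; the tree's `Torus.IsWeakScalarTransportOn.of_tendsto` is the unforced fixed-viscosity
model): the class conjuncts are bookkeeping; for the weak identity, restrict the level-`k`
solutions to the horizon `S` (`rcLimit_isWeakScalarTransportForcedOn_of_le`), write the level-`k`
identity in product form and split
`ϑ(∂ₜψ + ⟪v, ∇ψ⟫ + νΔψ) = ϑ G + ϑ ⟪v - W', ∇ψ⟫ + ν ϑ Δψ`, `G = ∂ₜψ + ⟪W', ∇ψ⟫ + 0·Δψ`:
the first and the Laplacian pairing converge by weak convergence (so `ν ∫∫ ϑ Δψ → 0`), the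
transport error tends to zero by Cauchy–Schwarz (`v k → W'` in `L²` from the fluctuation mass and
the uniform convergence), the datum term converges by weak convergence in `L²(T²)`, and the
source term does not depend on `k`.

## References

* R. J. DiPerna, P.-L. Lions, Invent. Math. 98 (1989), §II.1. [`DiPernaLions1989`]
* T. D. Drivas, T. M. Elgindi, G. Iyer, I.-J. Jeong, ARMA 243 (2022), (1.1). [`DEIJ2022`]
-/

noncomputable section

namespace Summit.AnomalousDissipation.AnomalousDissipation.Theorems.TwohalfdNeg.RegularCondensate

open MeasureTheory Filter Topology Set Function
open scoped ENNReal NNReal InnerProductSpace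
open Literature.Analysis.FunctionSpaces Literature.Analysis.FluidPDE

-- the summit and the problem are both called `AnomalousDissipation` (path-aligned namespace)
set_option linter.dupNamespace false

/-- **RC-LIM `stub_rcLimit` — the limit on a block is a weak solution of the sourced TRANSPORT
equation.** Along a sequence of levels: restarted weak sourced scalars `ϑ k` on `[0, S+1)`
(viscosities `ν k → 0`, drifts `v k`, the same steady smooth source `h`, `L²` data `ϑ₀ k`),
uniformly bounded in `L²((0,S) × T²)`, whose drifts are `L²((0,S) × T²)`-asymptotic to bounded
continuous comparison flows `W k` converging UNIFORMLY on `[0,S] × T²` to a bounded continuous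
field `W'` that is weakly divergence free at every time; and weak limits `Θ` (against bounded
measurable space–time functions) and `Θ₀` (against `L²`) with the class bounds. THEN `Θ` is a
weak solution of `∂ₜΘ + W'·∇Θ = h` on `T² × [0, S)` with datum `Θ₀`. DiPerna–Lions passage to
the limit in the linear transport equation. [cite: DiPernaLions1989, §II.1] -/
theorem stub_rcLimit :
    ∀ (S : ℝ) (L C C₁ : ℝ) (h : UnitAddTorus (Fin 2) → ℝ) (ν : ℕ → ℝ)
      (v W : ℕ → ℝ → UnitAddTorus (Fin 2) → EuclideanSpace ℝ (Fin 2))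
      (W' : ℝ → UnitAddTorus (Fin 2) → EuclideanSpace ℝ (Fin 2))
      (ϑ₀ : ℕ → UnitAddTorus (Fin 2) → ℝ) (ϑ : ℕ → ℝ → UnitAddTorus (Fin 2) → ℝ)
      (Θ₀ : UnitAddTorus (Fin 2) → ℝ) (Θ : ℝ → UnitAddTorus (Fin 2) → ℝ),
      0 < S → Torus.IsSmooth h → Tendsto ν atTop (𝓝 0) →
      (∀ k, MemLp (ϑ₀ k) 2 volume) →
      (∀ k, Torus.IsWeakScalarTransportForcedOn (S + 1) (ν k) (v k) (fun _ => h) (ϑ₀ k) (ϑ k)) →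
      (∀ k, Integrable (fun p : ℝ × UnitAddTorus (Fin 2) => ϑ k p.1 p.2 ^ 2)
        (((volume : Measure ℝ).restrict (Set.Ioo 0 S)).prod volume)) →
      (∀ k, ∫ p, ϑ k p.1 p.2 ^ 2 ∂(((volume : Measure ℝ).restrict (Set.Ioo 0 S)).prod volume) ≤ C) →
      (∀ k, Continuous (Function.uncurry (W k))) → (∀ k t x, ‖W k t x‖ ≤ L) →
      Tendsto (fun k => ∫⁻ p, ‖v k p.1 p.2 - W k p.1 p.2‖ₑ ^ 2
        ∂(((volume : Measure ℝ).restrict (Set.Ioo 0 S)).prod volume)) atTop (𝓝 0) →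
      Continuous (Function.uncurry W') → (∀ t x, ‖W' t x‖ ≤ L) → (∀ t, Torus.IsWeaklyDivFree (W' t)) →
      (∀ δ : ℝ, 0 < δ → ∀ᶠ k in atTop, ∀ t ∈ Set.Icc 0 S, ∀ x, ‖W k t x - W' t x‖ ≤ δ) →
      AEStronglyMeasurable (Function.uncurry Θ) (((volume : Measure ℝ).restrict (Set.Ioo 0 S)).prod volume) →
      Integrable (fun p : ℝ × UnitAddTorus (Fin 2) => Θ p.1 p.2 ^ 2)
        (((volume : Measure ℝ).restrict (Set.Ioo 0 S)).prod volume) →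
      (∀ᵐ t ∂(volume.restrict (Set.Ioo 0 S)), ∫ x, Θ t x ^ 2 ≤ C₁) →
      MemLp Θ₀ 2 volume →
      (∀ G : ℝ × UnitAddTorus (Fin 2) → ℝ,
        AEStronglyMeasurable G (((volume : Measure ℝ).restrict (Set.Ioo 0 S)).prod volume) →
        (∃ M : ℝ, ∀ p, |G p| ≤ M) →
        Tendsto (fun k => ∫ p, ϑ k p.1 p.2 * G p ∂(((volume : Measure ℝ).restrict (Set.Ioo 0 S)).prod volume))
          atTop (𝓝 (∫ p, Θ p.1 p.2 * G p ∂(((volume : Measure ℝ).restrict (Set.Ioo 0 S)).prod volume)))) →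
      (∀ w : UnitAddTorus (Fin 2) → ℝ, MemLp w 2 volume →
        Tendsto (fun k => ∫ x, ϑ₀ k x * w x) atTop (𝓝 (∫ x, Θ₀ x * w x))) →
      Torus.IsWeakScalarTransportForcedOn S 0 W' (fun _ => h) Θ₀ Θ := by
  intro S L C C₁ h ν v W W' ϑ₀ ϑ Θ₀ Θ hS hh hν _hϑ₀ hsol hϑsq hϑC hWc _hWL hfl hW'c hW'L hdiv hunif
    hΘm hΘsq hΘC₁ _hΘ₀ hwlim hwlim₀
  -- the block measure
  set μ : Measure (ℝ × UnitAddTorus (Fin 2)) :=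
    ((volume : Measure ℝ).restrict (Ioo 0 S)).prod (volume : Measure (UnitAddTorus (Fin 2))) with hμ
  haveI : IsFiniteMeasure ((volume : Measure ℝ).restrict (Ioo 0 S)) :=
    isFiniteMeasure_restrict.2 measure_Ioo_lt_top.ne
  haveI : IsFiniteMeasure μ := by rw [hμ]; infer_instance
  have hae : ∀ᵐ p ∂μ, p.1 ∈ Ioo 0 S := Torus.IsWeakScalarTransportForcedOn.ae_fst_mem_Ioo S
  -- the level-`k` solutions restricted to the horizon `S`
  have hsol' : ∀ k, Torus.IsWeakScalarTransportForcedOn S (ν k) (v k) (fun _ => h) (ϑ₀ k) (ϑ k) :=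
    fun k => rcLimit_isWeakScalarTransportForcedOn_of_le (hsol k) (by linarith)
  -- the limit is in `L²`, hence in `L¹`, on the block
  have hΘL2 : MemLp (uncurry Θ) 2 μ := (memLp_two_iff_integrable_sq hΘm).2 hΘsq
  have hΘL1 : Integrable (uncurry Θ) μ := hΘL2.integrable one_le_two
  have hhc : Continuous h := hh.continuous
  have hL0 : 0 ≤ L := (norm_nonneg _).trans (hW'L 0 0)
  -- slice bound for the limit flow
  have hW'2 : ∀ t, ∫⁻ x, ‖W' t x‖ₑ ^ 2 ≤ ENNReal.ofReal L ^ 2 := by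
    intro t
    calc ∫⁻ x, ‖W' t x‖ₑ ^ 2 ≤ ∫⁻ _ : UnitAddTorus (Fin 2), ENNReal.ofReal L ^ 2 := by
          refine lintegral_mono fun x => ?_
          gcongr
          rw [← ofReal_norm]
          exact ENNReal.ofReal_le_ofReal (hW'L t x)
      _ = ENNReal.ofReal L ^ 2 := by rw [lintegral_const, measure_univ, mul_one]
  refine ⟨Torus.aestronglyMeasurable_stLift_of_uncurry hΘm,
    Torus.aestronglyMeasurable_stLift_of_uncurry hW'c.aestronglyMeasurable,
    Torus.aestronglyMeasurable_stLift_of_uncurry (u := fun _ => h)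
      (hhc.comp continuous_snd).aestronglyMeasurable,
    ⟨C₁.toNNReal, ?_⟩, ?_, ?_, ?_, ae_of_all _ hdiv, fun ψ hψ => ?_⟩
  · -- `Θ ∈ L^∞(0,S; L²)`
    filter_upwards [hΘC₁, hΘsq.prod_right_ae] with t ht hint
    have hint' : Integrable (fun y => Θ t y ^ 2) volume := hint
    rw [rcWeakLimit_lintegral_enorm_sq_eq hint']
    exact ENNReal.ofReal_le_ofReal ht
  · -- `W' ∈ L¹(0,S; L²)`
    calc ∫⁻ t in Ioo 0 S, (∫⁻ x, ‖W' t x‖ₑ ^ 2) ^ (1 / 2 : ℝ)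
        ≤ ∫⁻ _ in Ioo 0 S, (ENNReal.ofReal L ^ 2) ^ (1 / 2 : ℝ) :=
          lintegral_mono fun t => ENNReal.rpow_le_rpow (hW'2 t) (by norm_num)
      _ < ⊤ := by
          rw [setLIntegral_const]
          exact ENNReal.mul_lt_top (ENNReal.rpow_lt_top_of_nonneg (by norm_num)
            (ENNReal.pow_ne_top ENNReal.ofReal_ne_top)) measure_Ioo_lt_top
  · -- `W' Θ ∈ L¹((0,S) × T²)`
    have hm : AEMeasurable (fun p : ℝ × UnitAddTorus (Fin 2) => ‖W' p.1 p.2‖ₑ * ‖Θ p.1 p.2‖ₑ) μ :=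
      hW'c.aestronglyMeasurable.enorm.mul hΘm.enorm
    calc ∫⁻ t in Ioo 0 S, ∫⁻ x, ‖W' t x‖ₑ * ‖Θ t x‖ₑ
        = ∫⁻ p, ‖W' p.1 p.2‖ₑ * ‖Θ p.1 p.2‖ₑ ∂μ := (lintegral_prod _ hm).symm
      _ ≤ ∫⁻ p, ENNReal.ofReal L * ‖uncurry Θ p‖ₑ ∂μ := by
          refine lintegral_mono fun p => ?_
          gcongr
          · rw [← ofReal_norm]
            exact ENNReal.ofReal_le_ofReal (hW'L _ _)
          · rfl
      _ = ENNReal.ofReal L * ∫⁻ p, ‖uncurry Θ p‖ₑ ∂μ := lintegral_const_mul' _ _ ENNReal.ofReal_ne_top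
      _ < ⊤ := ENNReal.mul_lt_top ENNReal.ofReal_lt_top hΘL1.2
  · -- `h ∈ L¹((0,S) × T²)`
    show ∫⁻ _ in Ioo 0 S, ∫⁻ x, ‖h x‖ₑ < ⊤
    rw [setLIntegral_const]
    exact ENNReal.mul_lt_top hhc.integrable_unitAddTorus.2 measure_Ioo_lt_top
  · -- ### the weak identity
    -- bounds on the test function over `[0,S] × T²`
    obtain ⟨K₁, hK₁⟩ := Torus.exists_bound_of_continuous_uncurry hψ.continuous_uncurry_timeDeriv 0 S
    obtain ⟨K₂, hK₂⟩ := Torus.exists_bound_of_continuous_uncurry hψ.continuous_uncurry_gradient 0 S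
    obtain ⟨K₃, hK₃⟩ := Torus.exists_bound_of_continuous_uncurry hψ.continuous_uncurry_laplacian 0 S
    have hψc : Continuous (uncurry ψ) := Torus.continuous_uncurry_of_continuous_stLift hψ.1.continuous
    obtain ⟨K₀, hK₀⟩ := Torus.exists_bound_of_continuous_uncurry hψc 0 S
    have hψ0c : Continuous (ψ 0) := hψc.comp (Continuous.prodMk_right 0)
    -- the pieces of the weak integrand
    set G : ℝ × UnitAddTorus (Fin 2) → ℝ := fun p =>
      Torus.timeDeriv ψ p.1 p.2 + ⟪W' p.1 p.2, Torus.gradient (ψ p.1) p.2⟫_ℝ +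
        0 * Torus.laplacian (ψ p.1) p.2 with hG
    set Lp : ℝ × UnitAddTorus (Fin 2) → ℝ := fun p => Torus.laplacian (ψ p.1) p.2 with hLp
    set H : ℕ → ℝ × UnitAddTorus (Fin 2) → ℝ := fun k p =>
      ⟪v k p.1 p.2 - W' p.1 p.2, Torus.gradient (ψ p.1) p.2⟫_ℝ with hH
    have hGm : AEStronglyMeasurable G μ := by
      refine Continuous.aestronglyMeasurable ?_
      exact (hψ.continuous_uncurry_timeDeriv.add (hW'c.inner hψ.continuous_uncurry_gradient)).add
        (continuous_const.mul hψ.continuous_uncurry_laplacian)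
    have hGbd : ∀ p : ℝ × UnitAddTorus (Fin 2), p.1 ∈ Icc 0 S → |G p| ≤ K₁ + L * K₂ := by
      intro p hp
      have h1 : |Torus.timeDeriv ψ p.1 p.2| ≤ K₁ := by
        rw [← Real.norm_eq_abs]; exact hK₁ p.1 hp p.2
      have h2 : |⟪W' p.1 p.2, Torus.gradient (ψ p.1) p.2⟫_ℝ| ≤ L * K₂ :=
        (abs_real_inner_le_norm _ _).trans
          (mul_le_mul (hW'L _ _) (hK₂ p.1 hp p.2) (norm_nonneg _) hL0)
      simp only [hG, zero_mul, add_zero]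
      exact (abs_add_le _ _).trans (add_le_add h1 h2)
    have hGbd' : ∀ᵐ p ∂μ, ‖G p‖ ≤ K₁ + L * K₂ := by
      filter_upwards [hae] with p hp
      rw [Real.norm_eq_abs]
      exact hGbd p (Ioo_subset_Icc_self hp)
    have hLpm : AEStronglyMeasurable Lp μ := hψ.continuous_uncurry_laplacian.aestronglyMeasurable
    have hLpbd : ∀ p : ℝ × UnitAddTorus (Fin 2), p.1 ∈ Icc 0 S → |Lp p| ≤ K₃ := by
      intro p hp
      rw [← Real.norm_eq_abs]
      exact hK₃ p.1 hp p.2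
    have hLpbd' : ∀ᵐ p ∂μ, ‖Lp p‖ ≤ K₃ := by
      filter_upwards [hae] with p hp
      rw [Real.norm_eq_abs]
      exact hLpbd p (Ioo_subset_Icc_self hp)
    -- (a) weak convergence of the main pairing and of the Laplacian pairing
    have hA : Tendsto (fun k => ∫ p, ϑ k p.1 p.2 * G p ∂μ) atTop (𝓝 (∫ p, Θ p.1 p.2 * G p ∂μ)) :=
      rcLimit_tendsto_integral_mul_of_forall_abs_le hwlim hGm hGbd
    have hB : Tendsto (fun k => ν k * ∫ p, ϑ k p.1 p.2 * Lp p ∂μ) atTop (𝓝 0) := by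
      have h1 := hν.mul (rcLimit_tendsto_integral_mul_of_forall_abs_le hwlim hLpm hLpbd)
      rwa [zero_mul] at h1
    -- (b) the transport error
    have hϑm : ∀ k, AEStronglyMeasurable (uncurry (ϑ k)) μ := fun k =>
      (hsol' k).aestronglyMeasurable_uncurry
    have hvm : ∀ k, AEStronglyMeasurable (uncurry (v k)) μ := fun k =>
      (hsol' k).aestronglyMeasurable_uncurry_velocity
    have hdm : ∀ k, AEStronglyMeasurable
        (fun q : ℝ × UnitAddTorus (Fin 2) => v k q.1 q.2 - W' q.1 q.2) μ := fun k =>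
      (hvm k).sub hW'c.aestronglyMeasurable
    have hgbd : ∀ᵐ p ∂μ, ‖Torus.gradient (ψ p.1) p.2‖ ≤ K₂ := by
      filter_upwards [hae] with p hp
      exact hK₂ p.1 (Ioo_subset_Icc_self hp) p.2
    have hJ : Tendsto (fun k => ∫ p, ϑ k p.1 p.2 * H k p ∂μ) atTop (𝓝 0) :=
      rcLimit_tendsto_integral_mul_inner_of_eLpNorm (f := fun k => uncurry (ϑ k)) hϑm
        (ENNReal.rpow_ne_top_of_nonneg (by norm_num) ENNReal.ofReal_ne_top)
        (fun k => rcLimit_eLpNorm_two_le_of_integral_sq_le (hϑsq k) (hϑC k)) hdm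
        (rcLimit_tendsto_eLpNorm_drift_sub hvm hWc hW'c hfl hunif) hgbd
    -- (c) the datum term
    have hψ0L2 : MemLp (ψ 0) 2 volume :=
      MemLp.of_bound hψ0c.aestronglyMeasurable K₀ (ae_of_all _ fun x => hK₀ 0 ⟨le_rfl, hS.le⟩ x)
    have hD := hwlim₀ (ψ 0) hψ0L2
    -- (d) the level-`k` identities
    have hIsrc : Integrable (fun p : ℝ × UnitAddTorus (Fin 2) => h p.2 * ψ p.1 p.2) μ :=
      (hsol' 0).integrable_source_mul_test hψ
    have hident : ∀ k, ∫ p, ϑ k p.1 p.2 * G p ∂μ =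
        -(∫ p, ϑ k p.1 p.2 * H k p ∂μ) - ν k * (∫ p, ϑ k p.1 p.2 * Lp p ∂μ) -
          (∫ p, h p.2 * ψ p.1 p.2 ∂μ) - ∫ x, ϑ₀ k x * ψ 0 x := by
      intro k
      have h0 := (hsol' k).integral_prod_weak_eq hψ
      have hIG : Integrable (fun p : ℝ × UnitAddTorus (Fin 2) => ϑ k p.1 p.2 * G p) μ :=
        (hsol' k).integrable_uncurry.mul_bdd hGm hGbd'
      have hIL : Integrable (fun p : ℝ × UnitAddTorus (Fin 2) => ϑ k p.1 p.2 * Lp p) μ :=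
        (hsol' k).integrable_uncurry.mul_bdd hLpm hLpbd'
      have hIsum := (hsol' k).integrable_weakIntegrand hψ
      have hsplit : ∀ p : ℝ × UnitAddTorus (Fin 2), ϑ k p.1 p.2 *
          (Torus.timeDeriv ψ p.1 p.2 + ⟪v k p.1 p.2, Torus.gradient (ψ p.1) p.2⟫_ℝ +
            ν k * Torus.laplacian (ψ p.1) p.2) =
          ϑ k p.1 p.2 * G p + ϑ k p.1 p.2 * H k p + ν k * (ϑ k p.1 p.2 * Lp p) := by
        intro p
        simp only [hG, hH, hLp, inner_sub_left]
        ring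
      have hIH : Integrable (fun p : ℝ × UnitAddTorus (Fin 2) => ϑ k p.1 p.2 * H k p) μ := by
        refine ((hIsum.sub hIG).sub (hIL.const_mul (ν k))).congr (Eventually.of_forall fun p => ?_)
        simp only [Pi.sub_apply, hsplit p]
        ring
      have hIGH : Integrable
          (fun p : ℝ × UnitAddTorus (Fin 2) => ϑ k p.1 p.2 * G p + ϑ k p.1 p.2 * H k p) μ :=
        hIG.add hIH
      have h1 : (∫ p, ϑ k p.1 p.2 *
          (Torus.timeDeriv ψ p.1 p.2 + ⟪v k p.1 p.2, Torus.gradient (ψ p.1) p.2⟫_ℝ +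
            ν k * Torus.laplacian (ψ p.1) p.2) ∂μ) =
          (∫ p, ϑ k p.1 p.2 * G p ∂μ) + (∫ p, ϑ k p.1 p.2 * H k p ∂μ) +
            ν k * ∫ p, ϑ k p.1 p.2 * Lp p ∂μ := by
        rw [← integral_const_mul, ← integral_add hIG hIH,
          ← integral_add hIGH (hIL.const_mul _)]
        exact integral_congr_ae (Eventually.of_forall fun p => hsplit p)
      rw [h1] at h0
      linarith
    -- (e) pass to the limit
    have hlimit : Tendsto (fun k => ∫ p, ϑ k p.1 p.2 * G p ∂μ) atTop
        (𝓝 (-(0 : ℝ) - 0 - (∫ p, h p.2 * ψ p.1 p.2 ∂μ) - ∫ x, Θ₀ x * ψ 0 x)) :=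
      (((hJ.neg.sub hB).sub (tendsto_const_nhds (x := ∫ p, h p.2 * ψ p.1 p.2 ∂μ))).sub hD).congr
        fun k => (hident k).symm
    have hGeq := tendsto_nhds_unique hA hlimit
    have hIΘG : Integrable (fun p : ℝ × UnitAddTorus (Fin 2) => Θ p.1 p.2 * G p) μ :=
      hΘL1.mul_bdd hGm hGbd'
    have key : (∫ p, Θ p.1 p.2 * G p ∂μ) + (∫ p, h p.2 * ψ p.1 p.2 ∂μ) + ∫ x, Θ₀ x * ψ 0 x = 0 := by
      rw [hGeq]; ring
    rw [integral_prod _ hIΘG, integral_prod _ hIsrc] at key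
    exact key

end Summit.AnomalousDissipation.AnomalousDissipation.Theorems.TwohalfdNeg.RegularCondensate

end
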